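import Mathlib
import Literature.Analysis.FluidPDE.VectorCalculus

/-!
# Route `FilamentSkeletonRss` · crux `SkeletonJ1R` (stmt-NavierStokesRegularity-23610) — FRAME VOCABULARY (route-independent objects) of the registered line
# `streamline_kantorovich_R` (skeleton of record since 2026-08-29, lead `ns-fsr-lead-23610`) and of the shelf line `lia_switchoff_degree_R`

Definitions only (+ five elementary certificates about the switch/cutoff weights), `--supports stmt-NavierStokesRegularity-23610`; NO `Theses` import (the
heavy bricks about these objects — the LIA-reference IVP, the switched-field calculus, the streamline map — build on this file and are never rebuilt by a
route edit; the STATEMENTS of the stubs, which quantify over the split files' `StraightDatum` / `FlatJ1L` / `NearStraightJ1G`, live in the companion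
`…SkeletonJ1RLineDefs.lean`).  Step (0) of the lead's plan (starter memo `filament-plan/LEAD-23610-STARTER.md` §3).  Texts are VERBATIM the registered
skeleton `Cruxes/SkeletonJ1R/Lines/streamline_kantorovich_R.lean` (sha16 cbdaf3778dcf417e) §1–§3, whose §1 is the record `lia_switchoff_degree_R.lean` §1 and
whose §2 is the frame companion `lia_switchoff_degree_R_frame.lean` (credited: crux-strategists cstrat-23610-0 / -g2).

CONTENTS.  §1 the switched problem in a reference frame: `bsField` (the crux's regularised Biot–Savart field at rigid unit cores), `trueField`
(`u_X + ½y − αe₃×y`), `switchProfile` / `switchWeight` (smooth switch `χ(‖y‖²/ℓ² + 1 − 2s)`, `ℓ = Rb√(Γ log Γ)`), `waistPt`, `AdmissibleReference` /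
`AdmissibleModel` / `AdmissibleFrame` (the frame `(x, M)`: near-straight reference curves through the scaled datum waists with injective normal tubes, and an
outer model equal to the hyperbolic arm model `(7/4)τ·x′ − λz` in the tubes), `switchedField` (`σ·trueField + (1−σ)·M`), `SwitchedTangent`, `FineClass`,
`RegularWaist`.  §2 the LIA reference: `datumLine`, `ambientField` (partners' straight-datum Biot–Savart field + frame field), `liaCoeff`
(`β_j = Γγ_j log Γ/(8π)`), `refCutoff` (`= switchWeight ℓ (3/2)`: `1` on `‖y‖² ≤ 2ℓ²`, `0` beyond `3ℓ²`), `IsLiaReference` (the cut-off local-induction IVP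
`x″ = β⁻¹ φ(x) · x′ × W(x)`).  §3 `swDefect` (switched normal defect at `s = 1`, the quantity stubs F and L measure).  §4 certificates:
`switchWeight_eq_one_of_sq_le` / `switchWeight_eq_zero_of_le_sq` (where the switch is fully on / off at time `s`), `refCutoff_eq_one` / `refCutoff_eq_zero`,
`refCutoff_eq_one_of_switchWeight_pos` (the DESIGN RULE: wherever the true field is switched on at any `s ≤ 1`, the reference solves the FULL local-induction
balance), `liaReference_full_balance`.

The predicates here are route-posited CLASSES (hypotheses / conclusions of the stubs), never asserted.  HONEST FRAMING: vocabulary for the ∃-side DECIDING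
crux of a HYPOTHETICAL filament-type rotating-self-similar blow-up skeleton (MODEL rung, negative side of the NS ladder); nothing here proves, refutes or
moves any statement about Navier–Stokes regularity; `SkeletonJ1R` (23610), its heart `TangentSkeletonNearStraightL` (23320) and `Clause13RNearStraightL`
(23612) stay OPEN. [folklore]
-/

set_option linter.dupNamespace false -- `NavierStokesRegularity.NavierStokesRegularity` path/namespace repetition is the tree convention

noncomputable section

namespace Summit.NavierStokesRegularity.NavierStokesRegularity.Theorems.SkeletonJ1RFrame

open Set Function Filter MeasureTheory Real
open Literature.Analysis.FluidPDE
open scoped InnerProductSpace Topology BigOperators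

/-! ## §1 The switched problem in a reference frame (verbatim from the registered skeleton `Lines/streamline_kantorovich_R.lean` §1 = record `lia_switchoff_degree_R.lean` §1) -/

/-- The crux's regularised Biot–Savart field with RIGID UNIT CORES (`Aa ≡ 1`): the `u` of `FlatJ1L`'s hypothesis `hu` at `Aa k σ = 1`. -/
def bsField {N : ℕ} (Γ : ℝ) (γ : Fin N → ℝ) (Z : Fin N → ℝ → EuclideanSpace ℝ (Fin 3)) (y : EuclideanSpace ℝ (Fin 3)) :
    EuclideanSpace ℝ (Fin 3) :=
  ∑ k, (Γ*γ k/(4*Real.pi)) • ∫ σ:ℝ, ((‖y-Z k σ‖^2+Real.exp (-(1+Real.eulerMascheroniConstant-Real.log 2))*(1:ℝ))^(3/2:ℝ))⁻¹ •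
    cross (deriv (Z k) σ) (y-Z k σ)

/-- The TRUE rotating-frame field of the crux (hypothesis `hv` of `FlatJ1L`): `u_X y + ½ y − α e₃ × y`. -/
def trueField {N : ℕ} (Γ : ℝ) (γ : Fin N → ℝ) (α : ℝ) (X : Fin N → ℝ → EuclideanSpace ℝ (Fin 3)) (y : EuclideanSpace ℝ (Fin 3)) :
    EuclideanSpace ℝ (Fin 3) :=
  bsField Γ γ X y + (1/2:ℝ) • y - α • cross (EuclideanSpace.single 2 1) y

/-- Smooth switch profile: `= 1` on `(-∞, 0]`, `= 0` on `[1, ∞)`, values in `[0,1]` (Mathlib's `Real.smoothTransition`, reflected). -/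
def switchProfile (x : ℝ) : ℝ := Real.smoothTransition (1 - x)

/-- Switch weight at homotopy time `s`: `χ(‖y‖²/ℓ² + 1 − 2s)` — identically `0` at `s = 0`; at `s = 1` it is `1` on `‖y‖ ≤ ℓ` and `0` on
`‖y‖ ≥ √2·ℓ`; in between the true field is switched on in the ball `‖y‖² ≤ (2s−1)ℓ²` with a collar out to `‖y‖² = 2sℓ²`. -/
def switchWeight (ℓ s : ℝ) (y : EuclideanSpace ℝ (Fin 3)) : ℝ := switchProfile (‖y‖ ^ 2 / ℓ ^ 2 + 1 - 2 * s)

/-- Scaled datum waist point `√Γ • (p j + s₀ j • t j)`. -/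
def waistPt {N : ℕ} (Γ : ℝ) (p t : Fin N → EuclideanSpace ℝ (Fin 3)) (s₀ : Fin N → ℝ) (j : Fin N) : EuclideanSpace ℝ (Fin 3) :=
  Real.sqrt Γ • (p j + s₀ j • t j)

/-- ADMISSIBLE REFERENCE SKELETON (what the consumers use of it): unit-speed `C²` curves through the scaled datum waists, tilt `≤ Rb/8`
against the datum directions everywhere, curvature `√Γ‖x″‖ ≤ Rb/2`, pairwise separation `(ρ/2)√Γ`, and INJECTIVE normal tubes of radius
`ρ√Γ/8` (so that a field may be prescribed in normal-disc coordinates and the waist box `ρ√Γ/16` lies in the tube).  The intended instance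
is the local-induction reference of the header (S-bend turning `A·Rb² ≤ Rb/8` for `Rb ≤ 1/(8A)`, curvature `2A·Rb/√(log Γ) ≤ Rb/2` for
`log Γ ≥ 16A²`). -/
def AdmissibleReference {N : ℕ} (Γ ρ Rb : ℝ) (p t : Fin N → EuclideanSpace ℝ (Fin 3)) (s₀ : Fin N → ℝ)
    (x : Fin N → ℝ → EuclideanSpace ℝ (Fin 3)) : Prop :=
  (∀ j, ContDiff ℝ 2 (x j) ∧ (∀ τ, ‖deriv (x j) τ‖ = 1) ∧ x j 0 = waistPt Γ p t s₀ j) ∧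
    (∀ j τ, ‖deriv (x j) τ - t j‖ ≤ Rb / 8) ∧ (∀ j τ, ‖iteratedDeriv 2 (x j) τ‖ * Real.sqrt Γ ≤ Rb / 2) ∧
    (∀ j k, j ≠ k → ∀ τ σ, ρ / 2 * Real.sqrt Γ ≤ ‖x j τ - x k σ‖) ∧
    (∀ j k τ σ (z z' : EuclideanSpace ℝ (Fin 3)), ⟪z, deriv (x j) τ⟫_ℝ = 0 → ⟪z', deriv (x k) σ⟫_ℝ = 0 →
      ‖z‖ ≤ ρ * Real.sqrt Γ / 8 → ‖z'‖ ≤ ρ * Real.sqrt Γ / 8 → x j τ + z = x k σ + z' → j = k ∧ τ = σ ∧ z = z')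

/-- ADMISSIBLE OUTER MODEL about a reference `x`: a `C²` field of at most linear growth which, in normal-disc coordinates of radius `ρ√Γ/8`
about each reference curve, IS the linear hyperbolic arm model — axial rate `7/4` along the reference from its waist, normal contraction `λ`:
`M(x_j(τ) + z) = (7/4)τ · x_j′(τ) − λ z` for `z ⊥ x_j′(τ)`, `‖z‖ ≤ ρ√Γ/8`.  In particular `M(x_j 0) = 0` with derivative
`diag(7/4, −λ, −λ)` in the frame `(x_j′ 0, m, n)`, the reference is the oriented unstable streamline of that zero, and every other
streamline in the tube converges to the reference with slope `−λz/((7/4)τ)` (the exit-data SELECTION used by confinement).  Outside the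
tubes `M` is free (the construction blends into `½ y`). -/
def AdmissibleModel {N : ℕ} (Γ ρ lam : ℝ) (x : Fin N → ℝ → EuclideanSpace ℝ (Fin 3))
    (M : EuclideanSpace ℝ (Fin 3) → EuclideanSpace ℝ (Fin 3)) : Prop :=
  ContDiff ℝ 2 M ∧ (∃ C : ℝ, ∀ y, ‖M y‖ ≤ C * (1 + ‖y‖)) ∧
    ∀ j τ (z : EuclideanSpace ℝ (Fin 3)), ⟪z, deriv (x j) τ⟫_ℝ = 0 → ‖z‖ ≤ ρ * Real.sqrt Γ / 8 →
      M (x j τ + z) = ((7/4:ℝ) * τ) • deriv (x j) τ - lam • z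

/-- ADMISSIBLE FRAME = admissible reference + admissible model about it.  It is the SAME for every homotopy time `s` (only the switched-on
ball inflates); it is produced by the confinement prover (`∃` in `ConfinementL`) and consumed by the Leray–Schauder and output stubs (`∀`). -/
def AdmissibleFrame {N : ℕ} (Γ ρ lam Rb : ℝ) (p t : Fin N → EuclideanSpace ℝ (Fin 3)) (s₀ : Fin N → ℝ)
    (x : Fin N → ℝ → EuclideanSpace ℝ (Fin 3)) (M : EuclideanSpace ℝ (Fin 3) → EuclideanSpace ℝ (Fin 3)) : Prop :=
  AdmissibleReference Γ ρ Rb p t s₀ x ∧ AdmissibleModel Γ ρ lam x M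

/-- THE SWITCHED FIELD at homotopy time `s` generated by the skeleton `X` ITSELF, with outer model `M`:
`σ • trueField X y + (1 − σ) • M y`, `σ = switchWeight (Rb√(Γ log Γ)) s y`. -/
def switchedField {N : ℕ} (Γ Rb : ℝ) (γ : Fin N → ℝ) (α : ℝ) (M : EuclideanSpace ℝ (Fin 3) → EuclideanSpace ℝ (Fin 3))
    (s : ℝ) (X : Fin N → ℝ → EuclideanSpace ℝ (Fin 3)) (y : EuclideanSpace ℝ (Fin 3)) : EuclideanSpace ℝ (Fin 3) :=
  switchWeight (Rb * Real.sqrt (Γ * Real.log Γ)) s y • trueField Γ γ α X y +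
    (1 - switchWeight (Rb * Real.sqrt (Γ * Real.log Γ)) s y) • M y

/-- SWITCHED-TANGENT SKELETON at time `s` (verbatim shape of the registered line, model `M`): unit-speed `C²` curves, each GLOBALLY tangent to
the switched field it generates, through a zero of that field at parameter `0` (the waist), switched slip `≤ 0` before and `≥ 0` after the
waist (closed conditions), escaping to infinity. -/
def SwitchedTangent {N : ℕ} (Γ Rb : ℝ) (γ : Fin N → ℝ) (α : ℝ) (M : EuclideanSpace ℝ (Fin 3) → EuclideanSpace ℝ (Fin 3))
    (s : ℝ) (X : Fin N → ℝ → EuclideanSpace ℝ (Fin 3)) : Prop :=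
  ∀ j, ContDiff ℝ 2 (X j) ∧ (∀ τ, ‖deriv (X j) τ‖ = 1) ∧
    (∀ τ, switchedField Γ Rb γ α M s X (X j τ) = ⟪switchedField Γ Rb γ α M s X (X j τ), deriv (X j) τ⟫_ℝ • deriv (X j) τ) ∧
    switchedField Γ Rb γ α M s X (X j 0) = 0 ∧
    (∀ τ, 0 ≤ τ → 0 ≤ ⟪switchedField Γ Rb γ α M s X (X j τ), deriv (X j) τ⟫_ℝ) ∧
    (∀ τ, τ ≤ 0 → ⟪switchedField Γ Rb γ α M s X (X j τ), deriv (X j) τ⟫_ℝ ≤ 0) ∧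
    Tendsto (fun τ => ‖X j τ‖) (cocompact ℝ) atTop

/-- FINE SHADOWING CLASS (the a priori bounds) about the reference `x`: position `≤ Rb√Γ`, tilt `≤ Rb/4` against the shadowing reference
tangent, waist displacement `≤ Rb√Γ`, curvature `√Γ‖X″‖ ≤ Rb`, and the TRUE slip `w = ⟪trueField X (X j τ), X j′ τ⟫` is differentiable with
slope in `[3/2 + δ/2, Λ + 1]` at the waist and `|w′| ≤ Λ + 1` everywhere (verbatim slip clauses of the registered line). -/
def FineClass {N : ℕ} (Γ δ Λ Rb : ℝ) (γ : Fin N → ℝ) (α : ℝ) (x X : Fin N → ℝ → EuclideanSpace ℝ (Fin 3)) : Prop :=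
  ∀ j, (∀ τ, ∃ σ, ‖X j τ - x j σ‖ ≤ Rb * Real.sqrt Γ ∧ ‖deriv (X j) τ - deriv (x j) σ‖ ≤ Rb / 4) ∧
    ‖X j 0 - x j 0‖ ≤ Rb * Real.sqrt Γ ∧ (∀ τ, ‖iteratedDeriv 2 (X j) τ‖ * Real.sqrt Γ ≤ Rb) ∧
    Differentiable ℝ (fun τ => ⟪trueField Γ γ α X (X j τ), deriv (X j) τ⟫_ℝ) ∧
    3/2 + δ/2 ≤ deriv (fun τ => ⟪trueField Γ γ α X (X j τ), deriv (X j) τ⟫_ℝ) 0 ∧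
    (∀ τ, |deriv (fun τ => ⟪trueField Γ γ α X (X j τ), deriv (X j) τ⟫_ℝ) τ| ≤ Λ + 1)

/-- REGULAR WAIST at time `s` (verbatim shape of the registered line, in the reference frame): in the waist box of radius `ρ√Γ/16` about the
reference waist `x j 0` the switched field vanishes ONLY at `X j 0`, the switched slip along `X j` vanishes ONLY at `τ = 0`, and the derivative
of the switched field at the waist has `X j′ 0` as an eigenvector with positive eigenvalue and a normal block of negative trace and positive
determinant (saddle-focus, the clause-12 shape of the landed `NormalBlockMatchedL`).  At `s = 0` (field `= M`) this is the explicit arm-model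
computation `diag(7/4, −λ, −λ)`. -/
def RegularWaist {N : ℕ} (Γ ρ Rb : ℝ) (γ : Fin N → ℝ) (α : ℝ) (x : Fin N → ℝ → EuclideanSpace ℝ (Fin 3))
    (M : EuclideanSpace ℝ (Fin 3) → EuclideanSpace ℝ (Fin 3)) (s : ℝ) (X : Fin N → ℝ → EuclideanSpace ℝ (Fin 3)) : Prop :=
  ∀ j, (∀ y, ‖y - x j 0‖ ≤ ρ * Real.sqrt Γ / 16 → switchedField Γ Rb γ α M s X y = 0 → y = X j 0) ∧
    (∀ τ, ⟪switchedField Γ Rb γ α M s X (X j τ), deriv (X j) τ⟫_ℝ = 0 → τ = 0) ∧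
    ∃ (A : EuclideanSpace ℝ (Fin 3) →L[ℝ] EuclideanSpace ℝ (Fin 3)) (m n : EuclideanSpace ℝ (Fin 3)),
      A = fderiv ℝ (switchedField Γ Rb γ α M s X) (X j 0) ∧ Orthonormal ℝ ![deriv (X j) 0, m, n] ∧
      A (deriv (X j) 0) = ⟪A (deriv (X j) 0), deriv (X j) 0⟫_ℝ • deriv (X j) 0 ∧ 0 < ⟪A (deriv (X j) 0), deriv (X j) 0⟫_ℝ ∧
      ⟪A m, m⟫_ℝ + ⟪A n, n⟫_ℝ < 0 ∧ ⟪A n, m⟫_ℝ * ⟪A m, n⟫_ℝ < ⟪A m, m⟫_ℝ * ⟪A n, n⟫_ℝ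


/-! ## §2 The LIA reference (verbatim from `Lines/lia_switchoff_degree_R_frame.lean`) -/

/-- Scaled straight datum line `k`, parametrised by arclength from its waist point: `√Γ(p k + s₀ k • t k) + σ • t k`. -/
def datumLine {N : ℕ} (Γ : ℝ) (p t : Fin N → EuclideanSpace ℝ (Fin 3)) (s₀ : Fin N → ℝ) (k : Fin N) (σ : ℝ) : EuclideanSpace ℝ (Fin 3) :=
  waistPt Γ p t s₀ k + σ • t k

/-- The AMBIENT field seen by filament `j` in the reference problem: regularised Biot–Savart field (unit cores, the crux's kernel) of the
OTHER scaled straight datum lines, plus the frame field `½ y − α e₃ × y`.  (No self term: the self-induction of the reference is the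
local-induction term `β_j x′ × x″`, which `IsLiaReference` solves for.) -/
def ambientField {N : ℕ} (Γ : ℝ) (p t : Fin N → EuclideanSpace ℝ (Fin 3)) (γ : Fin N → ℝ) (α : ℝ) (s₀ : Fin N → ℝ) (j : Fin N)
    (y : EuclideanSpace ℝ (Fin 3)) : EuclideanSpace ℝ (Fin 3) :=
  (∑ k ∈ Finset.univ.erase j, (Γ*γ k/(4*Real.pi)) • ∫ σ:ℝ,
      ((‖y - datumLine Γ p t s₀ k σ‖^2+Real.exp (-(1+Real.eulerMascheroniConstant-Real.log 2))*(1:ℝ))^(3/2:ℝ))⁻¹ •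
        cross (t k) (y - datumLine Γ p t s₀ k σ)) +
    (1/2:ℝ) • y - α • cross (EuclideanSpace.single 2 1) y

/-- The local-induction (binormal) coefficient of filament `j` with a matched unit core at outer scale `√Γ`:
`β_j = (Γγ_j/4π)·(½ log Γ) = Γ γ_j log Γ/(8π)`.  (Any `O(log log Γ)` refinement of the logarithm changes the S-bend displacement by
`o(√Γ)` only; the prover may refine it.) -/
def liaCoeff {N : ℕ} (Γ : ℝ) (γ : Fin N → ℝ) (j : Fin N) : ℝ := Γ * γ j * Real.log Γ / (8 * Real.pi)

/-- The reference CUTOFF: `φ(y) = χ(‖y‖²/ℓ² − 2)` — equal to `1` on the closed final switched region `‖y‖² ≤ 2ℓ²` and to `0` for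
`‖y‖² ≥ 3ℓ²` (it is the switch weight at the fictitious time `s = 3/2`). -/
def refCutoff (ℓ : ℝ) (y : EuclideanSpace ℝ (Fin 3)) : ℝ := switchWeight ℓ (3/2) y

/-- THE LIA REFERENCE SKELETON: unit-speed `C²` curves shot from the scaled datum waists in the datum directions, solving the cut-off
local-induction tangency equation `x_j″ = β_j⁻¹ · φ(x_j) · x_j′ × W_j(x_j)` (`x′ × (x′ × x″) = −x″` at unit speed turns
`β_j x′×x″ = −W_j⊥` into this form).  It carries the full strain-driven S-bend on `‖y‖ ≤ √2·ℓ` and is straight beyond `‖y‖ ≥ √3·ℓ`.  An IVP: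
the right side is orthogonal to `x_j′`, so unit speed propagates, and it has linear growth, so the solution is global and unique. -/
def IsLiaReference {N : ℕ} (Γ Rb : ℝ) (p t : Fin N → EuclideanSpace ℝ (Fin 3)) (γ : Fin N → ℝ) (α : ℝ) (s₀ : Fin N → ℝ)
    (x : Fin N → ℝ → EuclideanSpace ℝ (Fin 3)) : Prop :=
  ∀ j, ContDiff ℝ 2 (x j) ∧ (∀ τ, ‖deriv (x j) τ‖ = 1) ∧ x j 0 = waistPt Γ p t s₀ j ∧ deriv (x j) 0 = t j ∧
    ∀ τ, iteratedDeriv 2 (x j) τ =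
      ((liaCoeff Γ γ j)⁻¹ * refCutoff (Rb * Real.sqrt (Γ * Real.log Γ)) (x j τ)) •
        cross (deriv (x j) τ) (ambientField Γ p t γ α s₀ j (x j τ))

/-! ## §3 The switched normal defect at full switch-on (verbatim from the registered skeleton §3) -/


/-- The SWITCHED NORMAL DEFECT at full switch-on `s = 1` of a skeleton `Z` (not necessarily unit-speed — it is differentiated along
`Z = x + s•Y` below): the component of the self-generated switched field at `Z j τ` normal to the tangent `Z_j′ τ`.  For unit-speed `Z` its
vanishing is the tangency clause of `SwitchedTangent … 1 Z`. -/
def swDefect {N : ℕ} (Γ Rb : ℝ) (γ : Fin N → ℝ) (α : ℝ) (M : EuclideanSpace ℝ (Fin 3) → EuclideanSpace ℝ (Fin 3))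
    (Z : Fin N → ℝ → EuclideanSpace ℝ (Fin 3)) (j : Fin N) (τ : ℝ) : EuclideanSpace ℝ (Fin 3) :=
  switchedField Γ Rb γ α M 1 Z (Z j τ) -
    (⟪switchedField Γ Rb γ α M 1 Z (Z j τ), deriv (Z j) τ⟫_ℝ / ‖deriv (Z j) τ‖ ^ 2) • deriv (Z j) τ

/-! ## §4 Elementary certificates about the switch and the cutoff (sorry-free; the design rule of the frame companion) -/

/-- At time `s` the switch weight is `1` wherever `‖y‖² ≤ (2s − 1)ℓ²` (`ℓ ≠ 0`); at `s = 1` this is the crux ball `‖y‖ ≤ ℓ`. [folklore] -/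
theorem switchWeight_eq_one_of_sq_le {ℓ s : ℝ} (hℓ : ℓ ≠ 0) {y : EuclideanSpace ℝ (Fin 3)} (hy : ‖y‖ ^ 2 ≤ (2 * s - 1) * ℓ ^ 2) :
    switchWeight ℓ s y = 1 := by
  unfold switchWeight switchProfile
  apply Real.smoothTransition.one_of_one_le
  have hℓ2 : 0 < ℓ ^ 2 := by positivity
  have : ‖y‖ ^ 2 / ℓ ^ 2 ≤ 2 * s - 1 := by
    rw [div_le_iff₀ hℓ2]; linarith
  linarith

/-- At time `s` the switch weight is `0` wherever `2sℓ² ≤ ‖y‖²` (`ℓ ≠ 0`); at `s = 1` this is `‖y‖ ≥ √2·ℓ` (pure model region), and at `s = 0`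
it is everywhere. [folklore] -/
theorem switchWeight_eq_zero_of_le_sq {ℓ s : ℝ} (hℓ : ℓ ≠ 0) {y : EuclideanSpace ℝ (Fin 3)} (hy : 2 * s * ℓ ^ 2 ≤ ‖y‖ ^ 2) :
    switchWeight ℓ s y = 0 := by
  unfold switchWeight switchProfile
  apply Real.smoothTransition.zero_of_nonpos
  have hℓ2 : 0 < ℓ ^ 2 := by positivity
  have : 2 * s ≤ ‖y‖ ^ 2 / ℓ ^ 2 := by
    rw [le_div_iff₀ hℓ2]; linarith
  linarith

/-- The cutoff is `1` on the closed final switched region `‖y‖² ≤ 2ℓ²` (`ℓ ≠ 0`). [folklore] -/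
theorem refCutoff_eq_one {ℓ : ℝ} (hℓ : ℓ ≠ 0) {y : EuclideanSpace ℝ (Fin 3)} (hy : ‖y‖ ^ 2 ≤ 2 * ℓ ^ 2) : refCutoff ℓ y = 1 :=
  switchWeight_eq_one_of_sq_le hℓ (by linarith)

/-- The cutoff vanishes for `‖y‖² ≥ 3ℓ²` (`ℓ ≠ 0`): the reference is straight there. [folklore] -/
theorem refCutoff_eq_zero {ℓ : ℝ} (hℓ : ℓ ≠ 0) {y : EuclideanSpace ℝ (Fin 3)} (hy : 3 * ℓ ^ 2 ≤ ‖y‖ ^ 2) : refCutoff ℓ y = 0 :=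
  switchWeight_eq_zero_of_le_sq hℓ (by linarith)

/-- DESIGN RULE.  The switched region at any time `s ≤ 1` lies inside the region where the cutoff is `1`: if the switch weight is positive at `y` then
`‖y‖² < 2sℓ² ≤ 2ℓ²`, hence `refCutoff ℓ y = 1`. [folklore] -/
theorem refCutoff_eq_one_of_switchWeight_pos {ℓ s : ℝ} (hℓ : ℓ ≠ 0) (hs : s ≤ 1) {y : EuclideanSpace ℝ (Fin 3)}
    (hy : 0 < switchWeight ℓ s y) : refCutoff ℓ y = 1 := by
  apply refCutoff_eq_one hℓ
  have hℓ2 : 0 < ℓ ^ 2 := by positivity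
  by_contra h
  push Not at h
  have : switchWeight ℓ s y = 0 := switchWeight_eq_zero_of_le_sq hℓ (by nlinarith)
  linarith

/-- Where the cutoff is `1` the reference equation is the FULL local-induction balance; in particular, by the previous lemma, wherever the true field is
switched on at all (any `s ≤ 1`). [folklore] -/
theorem liaReference_full_balance {N : ℕ} {Γ Rb : ℝ} {p t : Fin N → EuclideanSpace ℝ (Fin 3)} {γ : Fin N → ℝ} {α : ℝ}
    {s₀ : Fin N → ℝ} {x : Fin N → ℝ → EuclideanSpace ℝ (Fin 3)} (hx : IsLiaReference Γ Rb p t γ α s₀ x) (j : Fin N) (τ : ℝ)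
    (hcut : refCutoff (Rb * Real.sqrt (Γ * Real.log Γ)) (x j τ) = 1) :
    iteratedDeriv 2 (x j) τ = (liaCoeff Γ γ j)⁻¹ • cross (deriv (x j) τ) (ambientField Γ p t γ α s₀ j (x j τ)) := by
  obtain ⟨_, _, _, _, hode⟩ := hx j
  rw [hode τ, hcut, mul_one]

/-! ## §5 RESHAPE (lead `ns-fsr-lead-23610` g0, 2026-08-29): the DATUM-SLICED frame

The registered line's stubs F / L / K (and stub D) consume the frame only through (a) the reference's waist points, tilt `≤ Rb/8`, curvature
`√Γ‖x″‖ ≤ Rb/2` and separation `(ρ/2)√Γ`, and (b) an outer model that is TANGENT to the reference with the arm speed, `M(x_j τ) = (7/4)τ·x_j′ τ`, and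
CONTRACTS the slices transverse to it at rate `λ`.  `AdmissibleModel` (§1, the record's text) prescribes the model on slices NORMAL TO THE CURVE
(`z ⊥ x_j′ τ`), and `AdmissibleReference` asks for injective normal tubes; producing such an `M` of class `C²` needs the nearest-point projection onto
a curved reference (tubular-neighbourhood calculus the tree does not have).  Slicing instead by the planes normal to the DATUM DIRECTION `t_j`
(`z ⊥ t_j`) makes everything explicit: the axial coordinate `a_j(y) = ⟪y − x_j 0, t_j⟫` is linear, `τ ↦ a_j(x_j τ)` is a diffeomorphism of `ℝ` for a
reference with tilt `< 1`, so `h_j := (a_j ∘ x_j)⁻¹ ∘ a_j` is a smooth global retraction `h_j(x_j τ + z) = τ` (`z ⊥ t_j`), and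
`M_j(y) := (7/4)h_j(y)·x_j′(h_j y) − λ(y − x_j(h_j y))` is a smooth field on all of `ℝ³` satisfying the slice formula exactly; the slices are
automatically injective per curve, and across curves by separation.  The streamline dynamics in sliced coordinates are the same
(`τ̇ = (7/4)τ`, `ż = −λz`), so stub K loses nothing.  `SlicedReference` / `SlicedModel` / `SlicedFrame` below replace `AdmissibleReference` /
`AdmissibleModel` / `AdmissibleFrame` in the registered stub statements (companion `…SkeletonJ1RLineDefs.lean`); the §1 predicates stay for the shelf
line `lia_switchoff_degree_R`, whose texts use them. -/

/-- DATUM-SLICED REFERENCE SKELETON (reshape of `AdmissibleReference`, lead g0): unit-speed `C²` curves through the scaled datum waists, tilt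
`≤ Rb/8` against the datum directions everywhere, curvature `√Γ‖x″‖ ≤ Rb/2`, pairwise separation `(ρ/2)√Γ`.  (No tube clause: slices normal to the
datum direction `t_j` are injective for free once the tilt is `< 1`.)  (route-posited predicate; not a Literature fact) -/
def SlicedReference {N : ℕ} (Γ ρ Rb : ℝ) (p t : Fin N → EuclideanSpace ℝ (Fin 3)) (s₀ : Fin N → ℝ)
    (x : Fin N → ℝ → EuclideanSpace ℝ (Fin 3)) : Prop :=
  (∀ j, ContDiff ℝ 2 (x j) ∧ (∀ τ, ‖deriv (x j) τ‖ = 1) ∧ x j 0 = waistPt Γ p t s₀ j) ∧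
    (∀ j τ, ‖deriv (x j) τ - t j‖ ≤ Rb / 8) ∧ (∀ j τ, ‖iteratedDeriv 2 (x j) τ‖ * Real.sqrt Γ ≤ Rb / 2) ∧
    (∀ j k, j ≠ k → ∀ τ σ, ρ / 2 * Real.sqrt Γ ≤ ‖x j τ - x k σ‖)

/-- DATUM-SLICED OUTER MODEL about a reference `x` with datum directions `t` (reshape of `AdmissibleModel`, lead g0): a `C²` field of at most
linear growth which, on the slices NORMAL TO THE DATUM DIRECTION of radius `ρ√Γ/8` about each reference curve, IS the linear hyperbolic arm model —
axial rate `7/4` along the reference from its waist, slice contraction `λ`: `M(x_j(τ) + z) = (7/4)τ · x_j′(τ) − λ z` for `z ⊥ t_j`, `‖z‖ ≤ ρ√Γ/8`.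
In particular `M(x_j τ) = (7/4)τ · x_j′(τ)` (the model is tangent to the reference with the arm speed), `M(x_j 0) = 0`, the reference is the oriented
unstable streamline of that zero, and in sliced coordinates every other streamline obeys `τ̇ = (7/4)τ`, `ż = −λz`.  (route-posited predicate;
not a Literature fact) -/
def SlicedModel {N : ℕ} (Γ ρ lam : ℝ) (t : Fin N → EuclideanSpace ℝ (Fin 3)) (x : Fin N → ℝ → EuclideanSpace ℝ (Fin 3))
    (M : EuclideanSpace ℝ (Fin 3) → EuclideanSpace ℝ (Fin 3)) : Prop :=
  ContDiff ℝ 2 M ∧ (∃ C : ℝ, ∀ y, ‖M y‖ ≤ C * (1 + ‖y‖)) ∧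
    ∀ j τ (z : EuclideanSpace ℝ (Fin 3)), ⟪z, t j⟫_ℝ = 0 → ‖z‖ ≤ ρ * Real.sqrt Γ / 8 →
      M (x j τ + z) = ((7/4:ℝ) * τ) • deriv (x j) τ - lam • z

/-- DATUM-SLICED FRAME = sliced reference + sliced model about it (reshape of `AdmissibleFrame`, lead g0; the frame hypothesis of the registered
stubs F / L / K / D from 2026-08-29 on). (route-posited predicate; not a Literature fact) -/
def SlicedFrame {N : ℕ} (Γ ρ lam Rb : ℝ) (p t : Fin N → EuclideanSpace ℝ (Fin 3)) (s₀ : Fin N → ℝ)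
    (x : Fin N → ℝ → EuclideanSpace ℝ (Fin 3)) (M : EuclideanSpace ℝ (Fin 3) → EuclideanSpace ℝ (Fin 3)) : Prop :=
  SlicedReference Γ ρ Rb p t s₀ x ∧ SlicedModel Γ ρ lam t x M

/-- The sliced model is tangent to the reference with the arm speed: `M (x_j τ) = (7/4)τ · x_j′ τ` (the slice formula at `z = 0`; needs
`0 ≤ ρ√Γ`). [folklore] -/
theorem SlicedModel.apply_ref {N : ℕ} {Γ ρ lam : ℝ} {t : Fin N → EuclideanSpace ℝ (Fin 3)} {x : Fin N → ℝ → EuclideanSpace ℝ (Fin 3)}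
    {M : EuclideanSpace ℝ (Fin 3) → EuclideanSpace ℝ (Fin 3)} (hM : SlicedModel Γ ρ lam t x M) (hρΓ : 0 ≤ ρ * Real.sqrt Γ)
    (j : Fin N) (τ : ℝ) : M (x j τ) = ((7/4:ℝ) * τ) • deriv (x j) τ := by
  have h := hM.2.2 j τ 0 (inner_zero_left _) (by rw [norm_zero]; positivity)
  rwa [add_zero, smul_zero, sub_zero] at h

end Summit.NavierStokesRegularity.NavierStokesRegularity.Theorems.SkeletonJ1RFrame

end
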